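import Summits.QuantumFields.YangMills.Theses.FemtoCutoffLadder
import Summits.QuantumFields.YangMills.Theorems.FemtoTransferGapBounds
import Summits.QuantumFields.YangMills.Theorems.FemtoTransferGapLevelsPos
import Summits.QuantumFields.YangMills.Theorems.FemtoCutoffLadderWindowCoupling

/-!
# Route `FemtoCutoffLadder` — the small-field split of `OctaveStepDecay` (stmt-QuantumFields-24153) survives an `L`-INDEPENDENT
# large-field allowance: `SmallFieldOctaveStep → LargeFieldInsensitivity′ → OctaveStepDecay`

Lead seat `ym-line-fcl-p1` g8 (2026-08-28).  The rev-12 child `LargeFieldInsensitivity` (stmt-QuantumFields-25696) asks that deleting the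
configurations with a plaquette deviation above `β^{κ−1}` move the femto gap by `≤ CΛ²/L^σ` for EVERY `σ > 0`.  Along the window the bare
coupling is only logarithmic in the lattice size (`4b₀ log L < β ≤ 13/lam³ + 26 b₀ log L`, `FemtoCutoffLadderWindowCoupling`), so the
per-plaquette large-field probability `≈ e^{−cβ^κ}` is bounded below along the window by `e^{−c(13/lam³ + 26b₀ log L)^κ}`, which decays slower
than any power of `L`: a power-of-`L` rate for large-field insensitivity is not what Bałaban's large-field suppression gives (it gives an
`L`-UNIFORM, `β`-small correction).  This file certifies that the split does not need the power rate from the large-field half: the weaker child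

  `LargeFieldInsensitivity′` := `LargeFieldInsensitivity` with slack `exp(CΛ²/L^σ + A/β²)` in place of `exp(CΛ²/L^σ)` (`A ≥ 0` existential)

still glues with `SmallFieldOctaveStep` (stmt-QuantumFields-25695) to the parent `OctaveStepDecay` BY NAME, because at a matched octave pair the
two allowances `A/β² + A/β'²` are absorbed by the telescoping term: `≤ (3A/(2b₀ log 2))·(1/β' − 1/β)` (`sq_slack_le_telescoping`; the pair is
separated by `β − β' ≥ 4b₀ log 2`).  Output constants: `C = C₁ + 2C₂`, `σ`, `D = D₁ + 3A/(2b₀ log 2)`, `lam0 = min`, tower base `L₀ˢ·2^{L₀ᴸ}`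
(the planner's glue `smallFieldSplitGlue_proof` verbatim otherwise).

★ `octaveStepDecay_of_smallField_of_largeFieldR : SmallFieldOctaveStep → LargeFieldInsensitivity′ → OctaveStepDecay`
(`LargeFieldInsensitivity′` spelled out as a hypothesis; no new definition).

HONEST FRAMING: bookkeeping; neither child is proved here, both sit behind `UVStabilityNonUniqueness` (two-cutoff control of transfer spectral
data).  R2b1 is a RECORD rung — not infinite volume, not a mass gap, not Clay; no summit is proved by this line.  No definitions, no named
facts, no `sorry`.
-/

set_option autoImplicit false

noncomputable section

namespace Summit.QuantumFields.YangMills.Theorems.FemtoCutoffLadder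

open Summit.QuantumFields.YangMills.Theorems.FemtoTransferGap
open Summit.QuantumFields.YangMills.Theses.FemtoCutoffLadder

/-- ★ **The repaired small-field split glues**: `SmallFieldOctaveStep` (25695) and the WEAKENED large-field insensitivity with slack
`exp(CΛ²/L^σ + A/β²)` (the lead's proposed restatement of 25696; spelled out) give `OctaveStepDecay` (24153) with
`C = C₁ + 2C₂`, `D = D₁ + 3A/(2b₀ log 2)` — the `β`-decaying, `L`-independent allowance is swallowed by the telescoping term of the tower
step (`WindowCoupling.sq_slack_le_telescoping`). [folklore] -/
theorem octaveStepDecay_of_smallField_of_largeFieldR (hA : SmallFieldOctaveStep)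
    (hB : ∀ κ σ : ℝ, 0 < κ → κ < 1 → 0 < σ → ∃ (C A lam0 : ℝ) (L0 : ℕ), 0 ≤ C ∧ 0 ≤ A ∧ 0 < lam0 ∧
      ∀ lam : ℝ, 0 < lam → lam ≤ lam0 → ∀ (L : ℕ) [NeZero L], L0 ≤ L → ∀ β : ℝ, InFemtoWindow lam β L →
        let P : (Literature.MathematicalPhysics.QuantumFieldTheory.GaugeConfig 3 L SU2 → ℝ) → Prop := fun ψ => ∀ U,
          (∃ p : Literature.MathematicalPhysics.QuantumFieldTheory.Plaquette 3 L, β ^ (κ - 1) <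
            2 - (su2Rep (Literature.MathematicalPhysics.QuantumFieldTheory.plaquetteHolonomy U p.1 p.2.1.1 p.2.1.2)).trace.re) → ψ U = 0
        0 < sSup (rayleighSet su2Rep L β P) ∧
        secondValue su2Rep L β ^ L * sSup (rayleighSet su2Rep L β P) ^ L ≤
          Real.exp (C * luscherLambda β L ^ 2 / (L : ℝ) ^ σ + A / β ^ 2) *
            (sInf {x : ℝ | ∃ φ : Literature.MathematicalPhysics.QuantumFieldTheory.GaugeConfig 3 L SU2 → ℝ, IsPhys φ ∧
              x = sSup (rayleighSet su2Rep L β fun ψ => P ψ ∧ l2 ψ φ = 0)} ^ L * topValue su2Rep L β ^ L) ∧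
        sInf {x : ℝ | ∃ φ : Literature.MathematicalPhysics.QuantumFieldTheory.GaugeConfig 3 L SU2 → ℝ, IsPhys φ ∧
            x = sSup (rayleighSet su2Rep L β fun ψ => P ψ ∧ l2 ψ φ = 0)} ^ L * topValue su2Rep L β ^ L ≤
          Real.exp (C * luscherLambda β L ^ 2 / (L : ℝ) ^ σ + A / β ^ 2) *
            (secondValue su2Rep L β ^ L * sSup (rayleighSet su2Rep L β P) ^ L)) :
    OctaveStepDecay := by
  obtain ⟨C₁, σ, D, κ, lam₁, L₁, hL₁, hσ, hκ, hκ1, hlam₁, hC₁, hD, hA⟩ := hA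
  obtain ⟨C₂, A, lam₂, L₂, hC₂, hA0, hlam₂, hB⟩ := hB κ σ hκ hκ1 hσ
  have hb0 : 0 < b0 := by unfold b0; positivity
  have hlog2 : 0 < Real.log 2 := Real.log_pos (by norm_num)
  refine ⟨C₁ + 2 * C₂, σ, D + 3 * A / (2 * b0 * Real.log 2), min lam₁ lam₂, L₁ * 2 ^ L₂, ?_, hσ, lt_min hlam₁ hlam₂,
    ?_, ?_⟩
  · positivity
  · positivity
  intro lam hlam hle i L' _ L _ hL' hL β β' hW hW' hmatch
  have hle₁ : lam ≤ lam₁ := le_trans hle (min_le_left _ _)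
  have hle₂ : lam ≤ lam₂ := le_trans hle (min_le_right _ _)
  -- `L'` is the member of index `L₂ + i` of the A-tower, and `L' ≥ 2^{L₂} ≥ L₂`
  have hL'A : L' = L₁ * 2 ^ (L₂ + i) := by rw [hL', pow_add, mul_assoc]
  have h2pow : 2 ^ L₂ ≤ L' := by
    rw [hL']
    calc 2 ^ L₂ ≤ L₁ * 2 ^ L₂ := Nat.le_mul_of_pos_left _ hL₁
      _ ≤ L₁ * 2 ^ L₂ * 2 ^ i := Nat.le_mul_of_pos_right _ (by positivity)
  have hL'ge : L₂ ≤ L' := le_trans (Nat.lt_two_pow_self).le h2pow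
  have hLge : L₂ ≤ L := by omega
  have hA1 := hA lam hlam hle₁ (L₂ + i) L' L hL'A hL β β' hW hW' hmatch
  obtain ⟨ht, hB1, -⟩ := hB lam hlam hle₂ L hLge β hW
  obtain ⟨ht', -, hB2⟩ := hB lam hlam hle₂ L' hL'ge β' hW'
  simp only [] at hA1 hB1 hB2 ht ht'
  -- names
  set S := secondValue su2Rep L β ^ L
  set T := topValue su2Rep L β ^ L
  set S' := secondValue su2Rep L' β' ^ L'
  set T' := topValue su2Rep L' β' ^ L'
  set P : (Literature.MathematicalPhysics.QuantumFieldTheory.GaugeConfig 3 L SU2 → ℝ) → Prop := fun ψ => ∀ U,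
    (∃ p : Literature.MathematicalPhysics.QuantumFieldTheory.Plaquette 3 L, β ^ (κ - 1) <
      2 - (su2Rep (Literature.MathematicalPhysics.QuantumFieldTheory.plaquetteHolonomy U p.1 p.2.1.1 p.2.1.2)).trace.re) → ψ U = 0
    with hP
  set P' : (Literature.MathematicalPhysics.QuantumFieldTheory.GaugeConfig 3 L' SU2 → ℝ) → Prop := fun ψ => ∀ U,
    (∃ p : Literature.MathematicalPhysics.QuantumFieldTheory.Plaquette 3 L', β' ^ (κ - 1) <
      2 - (su2Rep (Literature.MathematicalPhysics.QuantumFieldTheory.plaquetteHolonomy U p.1 p.2.1.1 p.2.1.2)).trace.re) → ψ U = 0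
    with hP'
  set t := sSup (rayleighSet su2Rep L β P) ^ L
  set s := sInf {x : ℝ | ∃ φ : Literature.MathematicalPhysics.QuantumFieldTheory.GaugeConfig 3 L SU2 → ℝ, IsPhys φ ∧
    x = sSup (rayleighSet su2Rep L β fun ψ => P ψ ∧ l2 ψ φ = 0)} ^ L
  set t' := sSup (rayleighSet su2Rep L' β' P') ^ L'
  set s' := sInf {x : ℝ | ∃ φ : Literature.MathematicalPhysics.QuantumFieldTheory.GaugeConfig 3 L' SU2 → ℝ, IsPhys φ ∧
    x = sSup (rayleighSet su2Rep L' β' fun ψ => P' ψ ∧ l2 ψ φ = 0)} ^ L'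
  set E₁ := Real.exp (C₁ * luscherLambda β L ^ 2 / (L' : ℝ) ^ σ + D * (1 / β' - 1 / β))
  set E₂ := Real.exp (C₂ * luscherLambda β L ^ 2 / (L : ℝ) ^ σ + A / β ^ 2)
  set E₃ := Real.exp (C₂ * luscherLambda β' L' ^ 2 / (L' : ℝ) ^ σ + A / β' ^ 2)
  -- positivity
  have htL : 0 < t := pow_pos ht _
  have htL' : 0 < t' := pow_pos ht' _
  have hT : 0 ≤ T := pow_nonneg (topValue_su2Rep_pos _ _).le _
  have hT' : 0 ≤ T' := pow_nonneg (topValue_su2Rep_pos _ _).le _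
  have hE₁ : 0 ≤ E₁ := (Real.exp_pos _).le
  have hE₂ : 0 ≤ E₂ := (Real.exp_pos _).le
  -- the division chain, cross-multiplied
  have key : S * T' * (t * t') ≤ E₂ * E₁ * E₃ * (S' * T) * (t * t') := by
    have c1 : S * T' * (t * t') ≤ E₂ * (s * T) * T' * t' := by
      have := mul_le_mul_of_nonneg_right (mul_le_mul_of_nonneg_right hB1 hT') htL'.le
      calc S * T' * (t * t') = S * t * T' * t' := by ring
        _ ≤ _ := this
    have c2 : E₂ * (s * T) * T' * t' ≤ E₂ * T * T' * (E₁ * (s' * t)) := by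
      have := mul_le_mul_of_nonneg_left hA1 (mul_nonneg (mul_nonneg hE₂ hT) hT')
      calc E₂ * (s * T) * T' * t' = E₂ * T * T' * (s * t') := by ring
        _ ≤ _ := this
    have c3 : E₂ * T * T' * (E₁ * (s' * t)) ≤ E₂ * E₁ * T * t * (E₃ * (S' * t')) := by
      have := mul_le_mul_of_nonneg_left hB2 (mul_nonneg (mul_nonneg (mul_nonneg hE₂ hE₁) hT) htL.le)
      calc E₂ * T * T' * (E₁ * (s' * t)) = E₂ * E₁ * T * t * (s' * T') := by ring
        _ ≤ _ := this
    calc S * T' * (t * t') ≤ _ := c1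
      _ ≤ _ := c2
      _ ≤ _ := c3
      _ = E₂ * E₁ * E₃ * (S' * T) * (t * t') := by ring
  have key' : S * T' ≤ E₂ * E₁ * E₃ * (S' * T) := le_of_mul_le_mul_right key (mul_pos htL htL')
  -- exponent bookkeeping: `E₂ E₁ E₃ ≤ exp((C₁ + 2C₂)Λ²/L'^σ + (D + 3A/(2b₀ log 2))(1/β' − 1/β))`
  have hΛ : luscherLambda β' L' = luscherLambda β L := hmatch.symm
  have hΛpos : 0 < luscherLambda β L := luscherLambda_pos_of_window hlam hW
  have hL'pos : (0 : ℝ) < (L' : ℝ) := by exact_mod_cast Nat.pos_of_ne_zero (NeZero.ne L')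
  have hLL' : (L' : ℝ) ≤ (L : ℝ) := by exact_mod_cast (by omega : L' ≤ L)
  have hpowpos : 0 < (L' : ℝ) ^ σ := Real.rpow_pos_of_pos hL'pos σ
  have hpow_le : (L' : ℝ) ^ σ ≤ (L : ℝ) ^ σ := Real.rpow_le_rpow hL'pos.le hLL' hσ.le
  have hΛ2 : 0 ≤ luscherLambda β L ^ 2 := sq_nonneg _
  have hfrac : C₂ * luscherLambda β L ^ 2 / (L : ℝ) ^ σ ≤ C₂ * luscherLambda β L ^ 2 / (L' : ℝ) ^ σ :=
    div_le_div_of_nonneg_left (mul_nonneg hC₂ hΛ2) hpowpos hpow_le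
  -- the two `A/β²` allowances against the telescoping term
  have hslack : A / β ^ 2 + A / β' ^ 2 ≤ 3 * A / (2 * b0 * Real.log 2) * (1 / β' - 1 / β) :=
    WindowCoupling.sq_slack_le_telescoping hA0 hW.1 hW'.1 hL hΛpos hmatch
  have hexp : E₂ * E₁ * E₃ ≤ Real.exp ((C₁ + 2 * C₂) * luscherLambda β L ^ 2 / (L' : ℝ) ^ σ +
      (D + 3 * A / (2 * b0 * Real.log 2)) * (1 / β' - 1 / β)) := by
    have : E₂ * E₁ * E₃ = Real.exp ((C₂ * luscherLambda β L ^ 2 / (L : ℝ) ^ σ + A / β ^ 2) +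
        (C₁ * luscherLambda β L ^ 2 / (L' : ℝ) ^ σ + D * (1 / β' - 1 / β)) +
        (C₂ * luscherLambda β L ^ 2 / (L' : ℝ) ^ σ + A / β' ^ 2)) := by
      simp only [E₁, E₂, E₃, hΛ, ← Real.exp_add]
    rw [this]
    apply Real.exp_le_exp.mpr
    have hsplit : (C₁ + 2 * C₂) * luscherLambda β L ^ 2 / (L' : ℝ) ^ σ =
        C₁ * luscherLambda β L ^ 2 / (L' : ℝ) ^ σ + C₂ * luscherLambda β L ^ 2 / (L' : ℝ) ^ σ +
          C₂ * luscherLambda β L ^ 2 / (L' : ℝ) ^ σ := by ring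
    rw [hsplit]
    nlinarith
  have hS'T : 0 ≤ S' * T := mul_nonneg (pow_nonneg (secondValue_su2Rep_pos (L := L') (by linarith [hW'.1])).le _) hT
  calc S * T' ≤ E₂ * E₁ * E₃ * (S' * T) := key'
    _ ≤ _ := mul_le_mul_of_nonneg_right hexp hS'T

end Summit.QuantumFields.YangMills.Theorems.FemtoCutoffLadder

end
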